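import Summits.BirchSwinnertonDyer.Rank1Residual.X1.LocalStrictPackage
import HarnessLib

/-!
# THE LOCAL PACKAGE at a place `wp ∣ p`, index form `p · #E(K_wp)[p] · #𝓚 ≤ #𝓛` — in particular
# `p · #𝓚 ≤ #𝓛` with NO torsion hypothesis (the `e = 1` package)
# (cell `b2b-bsdres`, unit `b2b-bsdres-eisenstein-p1`, gen 21; X1R0-GAPMAP §29–§30, V99)

HONEST FRAMING (run/shared/lean/b2b/bsd-rank1-residual/, verbatim in every file): the goal of the
cell is to DELETE the COMBINATION-SHAPED residual classes of the Birch–Swinnerton-Dyer formula for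
ALL analytic-rank `≤ 1` elliptic curves over `ℚ` — "full BSD formula for every rank `≤ 1` curve in
class `C`" assembled STRICTLY from published theorems — so that the rank-`≤ 1` remainder becomes
exactly the CONSTRUCTION-SHAPED classes, which are TYPED (missing-input `Prop`s), NOT attempted.
This is not "finishing BSD". Sub-cell `b2b-bsdres-eisenstein-p1`: research route; NO CLAIM BEYOND
STATED CLASSES; nothing here changes a label; nothing is booked. THEOREMS ONLY — no definition, no
named fact introduced; Tate's local Euler–Poincaré characteristic (`hEP`, the tree's named fact) is a
HYPOTHESIS exactly as in gen 20's `X1/LocalStrictPackage`; the reduction functional `s`, the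
character `ψ` and the absence of fixed `p`-th roots of unity are HYPOTHESES discharged over `ℚ` in
the assembly files.

## What and why

Gen 20's `LocalStrictPackage.exists_strict_addSubgroup` produces, `K`-generally, a subgroup
`𝓛 ⊇ 𝓚_wp` of `H¹(K_wp, E[p])` of strict classes with `p² · #𝓚_wp ≤ #𝓛`, using `#E(K_wp)[p] ≥ p`
(`ht`, from a rational point of order `p`) in the last step of the count
`#H¹ · p² ≤ #𝓛 · #Z¹(Γ, A₀)`, `#H¹ = (t·N)²`, `#Z¹ = p·N`, `#𝓚 = t·N` (`t = #E(K_wp)[p]`,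
`N = #(𝒪/p)`). THIS FILE records what the same count gives WITHOUT `ht`:

* **`exists_strict_addSubgroup_mul_natCard`**: `p · t · #𝓚_wp ≤ #𝓛` (same `𝓛`, same strictness);
* **`exists_strict_addSubgroup_one`**: `p ^ 1 · #𝓚_wp ≤ #𝓛` — the local term `a ≥ 1` of
  X1R0-GAPMAP §14.1 at an anomalous prime for members with NO rational (indeed no `K_wp`-rational)
  point of order `p` (memo `V76-LOCAL-TERM-PLAN.md` §4.10 (c): `a = 1 + [c_E ∈ p^ℤ·(K_wp^×)^p]`; the
  kernel takes the guaranteed `1`). Consumer: the `δ = 0` members of route M at layers `n ≥ 1`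
  (census class `282310u@3`, member `282310u2`, `E(ℚ_3)[3] = 0`, binds at `t₁ + 1 = 8`).

References: [GreenbergLNM1716] §2 Prop. 2.4, §3 Lemma 3.4 (p. 89), §5 pp. 114–118;
[MilneADT2006] I Thm. 2.8, Cor. 2.3, Lemma 3.3; [SilvermanAEC2009] VII.§2, VIII.§1, X.§4.
-/

noncomputable section

open scoped Classical NNReal

open Function Field NumberField IsDedekindDomain WeierstrassCurve ValuativeRel
  Literature.NumberTheory.EllipticCurves Literature.NumberTheory.GaloisRepresentations
  IsDedekindDomain.HeightOneSpectrum
open Literature.NumberTheory.GaloisRepresentations.DiscreteGaloisModule (mu MuCarrier)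

set_option autoImplicit false

namespace Summit.BirchSwinnertonDyer.Rank1Residual.X1.LocalStrictPackageOne

open _root_.TopRep _root_.ContinuousCohomology

-- `K : Type` (universe 0), as FILES 6–9 / 23–24c and gen 20's package.
variable {K : Type} [Field K] [NumberField K] (V : WeierstrassCurve K) [V.IsElliptic]
  (p : ℕ) [hp : Fact p.Prime] (wp : HeightOneSpectrum (𝓞 K))
  {w : Valuation (AlgebraicClosure (wp.adicCompletion K)) ℝ≥0}
  (hw : ∀ x, (w x : ℝ) =
    spectralNorm (wp.adicCompletion K) (AlgebraicClosure (wp.adicCompletion K)) x)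
  {M : WeierstrassCurve ↥w.valuationSubring}
  (hMK : M.baseChange (AlgebraicClosure (wp.adicCompletion K)) =
    V.baseChange (AlgebraicClosure (wp.adicCompletion K)))
  {red : localPoints V (wp.adicCompletion K) →+
    (M.map (IsLocalRing.residue ↥w.valuationSubring)).toAffine.Point}
  (hred : ∀ P, red P = M.reducePoint (Affine.Point.congrEquiv hMK.symm P))

include hw hred in
/-- **THE LOCAL PACKAGE, index form `p · #E(K_wp)[p] · #𝓚 ≤ #𝓛`.** Let `V/K` be elliptic, `p`
prime, `wp` a finite place, `red` the good reduction of an `𝒪_w`-model of `V ⊗ \bar K_wp` (`hred`),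
`H' ≤ Γ_K`. Suppose: `A₀` is a group of order `p` and `s : E[p] →+ A₀` detects
`red ∘ pointsMap = Õ` (`hs_red`) and is INVARIANT under `Γ_{K_wp}` (`hs_anom` — at an anomalous prime
the local Galois group fixes `Ẽ[p]`); `ψ : Γ_{K_wp} → ℤ_p` is continuous, trivial on `res⁻¹(H')`,
with a UNIT value on some inertia element; `\bar K_wp` has no `Γ_{K_wp}`-fixed primitive `p`-th root
of unity; Tate's local Euler–Poincaré characteristic holds at `K_wp` (`hEP`). Then there is a
subgroup `𝓛 ≤ H¹(K_wp, E[p])` with `𝓚_wp ≤ 𝓛`, **`p · #E(K_wp)[p] · #𝓚_wp ≤ #𝓛`**, and every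
cocycle of every class of `𝓛` has `red(pointsMap(ψc g)) = Õ` for all `g ∈ I_{K_wp}` with
`res g ∈ H'`. (Gen 20's `LocalStrictPackage.exists_strict_addSubgroup` with the torsion
hypothesis `ht` removed from the count.)
[cite: GreenbergLNM1716, §3 Lemma 3.4 (p. 89), §5 pp. 114–118] [cite: MilneADT2006, I Thm. 2.8] -/
theorem exists_strict_addSubgroup_mul_natCard (H' : Subgroup (absoluteGaloisGroup K))
    (A₀ : Type) [AddCommGroup A₀] [Finite A₀] (hA₀ : Nat.card A₀ = p)
    (s : geomTorsion V (p : ℤ) →+ A₀)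
    (hs_red : ∀ Q : geomTorsion V (p : ℤ), s Q = 0 ↔
      red (pointsMap V (wp.adicCompletion K) ((Q : geomTorsion V (p : ℤ)) : geomPoints V)) = 0)
    (hs_anom : ∀ (g : absoluteGaloisGroup (wp.adicCompletion K)) (Q : geomTorsion V (p : ℤ)),
      s (absGaloisRestrict K (wp.adicCompletion K) g • Q) = s Q)
    (ψ : absoluteGaloisGroup (wp.adicCompletion K) →ₜ* Multiplicative ℤ_[p])
    (hI : ∃ g ∈ absInertia (wp.adicCompletion K), ¬ (p : ℤ_[p]) ∣ (ψ g).toAdd)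
    (hψH' : ∀ g : absoluteGaloisGroup (wp.adicCompletion K),
      absGaloisRestrict K (wp.adicCompletion K) g ∈ H' → ψ g = 1)
    (hEP : localEulerPoincareCharacteristic (wp.adicCompletion K))
    (hμ : ∀ ζ : MuCarrier (wp.adicCompletion K) (p ^ 1),
      (∀ σ : absoluteGaloisGroup (wp.adicCompletion K), mu (wp.adicCompletion K) (p ^ 1) σ ζ = ζ) →
        ζ = 0) :
    ∃ 𝓛 : AddSubgroup (galoisCohomology
        (GaloisRep.restrictField (wp.adicCompletion K) (V.torsionGaloisModule (p : ℤ))) 1),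
      V.kummerLocalConditionAt (p : ℤ) (wp.adicCompletion K) ≤ 𝓛 ∧
      p * Nat.card (nsmulAddMonoidHom p :
          (V.baseChange (wp.adicCompletion K)).toAffine.Point →+ _).ker *
        Nat.card (V.kummerLocalConditionAt (p : ℤ) (wp.adicCompletion K)) ≤ Nat.card 𝓛 ∧
      ∀ c ∈ 𝓛, ∀ ψc : contOneCocycles (DiscreteGaloisModule.toTopRep
          (GaloisRep.restrictField (wp.adicCompletion K) (V.torsionGaloisModule (p : ℤ)))),
        oneCocycleClass _ ψc = c →
        ∀ g : absoluteGaloisGroup (wp.adicCompletion K), g ∈ absInertia (wp.adicCompletion K) →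
          absGaloisRestrict K (wp.adicCompletion K) g ∈ H' →
          red (pointsMap V (wp.adicCompletion K) ((ψc.1 g : geomTorsion V (p : ℤ)) : geomPoints V))
            = 0 := by
  -- notation and instances
  letI : TopologicalSpace A₀ := ⊥
  haveI : DiscreteTopology A₀ := ⟨rfl⟩
  haveI : CharZero (wp.adicCompletion K) := charZero_adicCompletion wp
  haveI : NeZero p := ⟨hp.out.ne_zero⟩
  haveI : NeZero (p : ℤ) := ⟨by exact_mod_cast hp.out.ne_zero⟩
  haveI : Finite (geomTorsion V (p : ℤ)) := finite_geomTorsion_of_neZero V p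
  set Lw := wp.adicCompletion K
  set X := DiscreteGaloisModule.toTopRep
    (GaloisRep.restrictField Lw (V.torsionGaloisModule (p : ℤ))) with hX
  haveI hHfin : Finite (galoisCohomology
      (GaloisRep.restrictField Lw (V.torsionGaloisModule (p : ℤ))) 1) :=
    finite_galoisCohomology_one_adicCompletion wp _
  haveI : Finite (continuousCohomology 1 X) := hHfin
  have hpA : ∀ a : A₀, p ^ 1 • a = 0 := fun a ↦ by
    rw [pow_one, ← hA₀]; exact card_nsmul_eq_zero'
  -- `#Z¹(Γ, A₀) = p · #(𝒪/p)` and finiteness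
  obtain ⟨hZfin, hZ⟩ :=
    LocalTrivialCocyclesCount.natCard_contOneCocycles_trivial_eq_of_forall_mu Lw A₀ hEP hpA hμ
  haveI := hZfin
  -- the strict subgroup of `X1/StrictClassesIndex`
  let J : Subgroup (absoluteGaloisGroup Lw) :=
    absInertia Lw ⊓ H'.comap (absGaloisRestrict K Lw).toMonoidHom
  have hJ : ∀ g, g ∈ J ↔ g ∈ absInertia Lw ∧ absGaloisRestrict K Lw g ∈ H' := fun g ↦ by
    rw [Subgroup.mem_inf, Subgroup.mem_comap]; rfl
  have hsX : ∀ (g : absoluteGaloisGroup Lw) (x : X), s (X.ρ g x) = s x := fun g x ↦ hs_anom g x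
  obtain ⟨𝓛, hiff, hcount⟩ := StrictClassesIndex.exists_addSubgroup_strict X s
    continuous_of_discreteTopology hsX J
  -- `#{f | f(J) = 0} ≥ p²`
  have hKJ : p ^ 2 ≤ Nat.card {f : contOneCocycles
      (ContinuousRep.trivial (absoluteGaloisGroup Lw) ℤ A₀).toTopRep // ∀ g ∈ J, f.1 g = 0} :=
    LocalTwoCharacters.sq_le_natCard_subtype_of_unit_on_inertia Lw A₀ hA₀ ψ hI J
      (fun g hg ↦ ((hJ g).mp hg).1) (fun g hg ↦ hψH' g ((hJ g).mp hg).2)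
  -- cardinalities from `hEP`
  have hH : Nat.card (galoisCohomology
      (GaloisRep.restrictField Lw (V.torsionGaloisModule (p : ℤ))) 1) =
      (Nat.card (nsmulAddMonoidHom p : (V.baseChange Lw).toAffine.Point →+ _).ker *
        Nat.card (wp.adicCompletionIntegers K ⧸ Ideal.span {(p : wp.adicCompletionIntegers K)})) ^ 2 :=
    natCard_galoisCohomology_one_torsion_adicCompletion_eq_sq V wp p (hp.out.isPrimePow) hEP
  have hKum : Nat.card (V.kummerLocalConditionAt (p : ℤ) Lw) =
      Nat.card (nsmulAddMonoidHom p : (V.baseChange Lw).toAffine.Point →+ _).ker *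
        Nat.card (wp.adicCompletionIntegers K ⧸ Ideal.span {(p : wp.adicCompletionIntegers K)}) :=
    V.natCard_kummerLocalConditionAt_adicCompletion wp hp.out.ne_zero
  have hZ' : Nat.card (contOneCocycles (ContinuousRep.trivial (absoluteGaloisGroup Lw) ℤ A₀).toTopRep) =
      p * Nat.card (wp.adicCompletionIntegers K ⧸ Ideal.span {(p : wp.adicCompletionIntegers K)}) := by
    rw [hZ, hA₀, LocalStrictPackage.natCard_integer_quotient_natCast_eq]
  -- positivity of `N = #(𝒪/p)`
  haveI : Finite (V.kummerLocalConditionAt (p : ℤ) Lw) :=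
    V.finite_kummerLocalConditionAt_adicCompletion wp hp.out.ne_zero
  have hKpos : 0 < Nat.card (V.kummerLocalConditionAt (p : ℤ) Lw) := Nat.card_pos
  set t := Nat.card (nsmulAddMonoidHom p : (V.baseChange Lw).toAffine.Point →+ _).ker with htdef
  set N := Nat.card (wp.adicCompletionIntegers K ⧸ Ideal.span {(p : wp.adicCompletionIntegers K)})
    with hNdef
  have hNpos : 0 < N := by
    rcases Nat.eq_zero_or_pos N with h0 | h0
    · rw [hKum, h0, mul_zero] at hKpos; exact absurd hKpos (lt_irrefl 0)
    · exact h0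
  refine ⟨𝓛, fun c hc ↦ ?_, ?_, fun c hc ψc hψc g hgI hgH' ↦ ?_⟩
  · -- (i) Kummer classes are strict
    refine (hiff c).mpr fun ψc hψc g hg ↦ ?_
    rw [hs_red]
    refine LocalReductionStrict.forall_red_cocycle_eq_zero_of_mem_kummerLocalConditionAt V (p : ℤ)
      wp hw hMK hred ψc ?_ ((hJ g).mp hg).1
    rw [hψc]; exact hc
  · -- (ii) the index: `(tN)² p² ≤ #𝓛 · pN` gives `p · t · (tN) ≤ #𝓛`
    have h1 : Nat.card (galoisCohomology
        (GaloisRep.restrictField Lw (V.torsionGaloisModule (p : ℤ))) 1) * p ^ 2 ≤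
        Nat.card 𝓛 * (p * N) := by
      calc _ ≤ Nat.card (galoisCohomology
              (GaloisRep.restrictField Lw (V.torsionGaloisModule (p : ℤ))) 1) *
            Nat.card {f : contOneCocycles
              (ContinuousRep.trivial (absoluteGaloisGroup Lw) ℤ A₀).toTopRep // ∀ g ∈ J, f.1 g = 0} :=
            Nat.mul_le_mul_left _ hKJ
        _ ≤ _ := by rw [← hZ']; exact hcount
    rw [hH] at h1
    rw [hKum]
    have h2 : p * t * (t * N) * (p * N) ≤ Nat.card 𝓛 * (p * N) :=
      calc p * t * (t * N) * (p * N) = (t * N) ^ 2 * p ^ 2 := by ring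
        _ ≤ Nat.card 𝓛 * (p * N) := h1
    exact Nat.le_of_mul_le_mul_right h2 (Nat.mul_pos hp.out.pos hNpos)
  · -- (iii) strictness in terms of `red`
    exact (hs_red _).mp ((hiff c).mp hc ψc hψc g ((hJ g).mpr ⟨hgI, hgH'⟩))

include hw hred in
/-- **THE `e = 1` LOCAL PACKAGE (no torsion hypothesis):** under the hypotheses of
`exists_strict_addSubgroup_mul_natCard` there is `𝓛 ≤ H¹(K_wp, E[p])` with `𝓚_wp ≤ 𝓛`,
**`p ^ 1 · #𝓚_wp ≤ #𝓛`** (since `#E(K_wp)[p] ≥ 1`), and every cocycle of every class of `𝓛` strict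
on the inertia elements restricting into `H'` — the shape of FILE 24b's `(𝓛, h𝓛, hidx, hstrict)`
with `e = 1`. [cite: GreenbergLNM1716, §3 Lemma 3.4 (p. 89), §5 pp. 114–118] [cite: MilneADT2006, I Thm. 2.8] -/
theorem exists_strict_addSubgroup_one (H' : Subgroup (absoluteGaloisGroup K))
    (A₀ : Type) [AddCommGroup A₀] [Finite A₀] (hA₀ : Nat.card A₀ = p)
    (s : geomTorsion V (p : ℤ) →+ A₀)
    (hs_red : ∀ Q : geomTorsion V (p : ℤ), s Q = 0 ↔
      red (pointsMap V (wp.adicCompletion K) ((Q : geomTorsion V (p : ℤ)) : geomPoints V)) = 0)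
    (hs_anom : ∀ (g : absoluteGaloisGroup (wp.adicCompletion K)) (Q : geomTorsion V (p : ℤ)),
      s (absGaloisRestrict K (wp.adicCompletion K) g • Q) = s Q)
    (ψ : absoluteGaloisGroup (wp.adicCompletion K) →ₜ* Multiplicative ℤ_[p])
    (hI : ∃ g ∈ absInertia (wp.adicCompletion K), ¬ (p : ℤ_[p]) ∣ (ψ g).toAdd)
    (hψH' : ∀ g : absoluteGaloisGroup (wp.adicCompletion K),
      absGaloisRestrict K (wp.adicCompletion K) g ∈ H' → ψ g = 1)
    (hEP : localEulerPoincareCharacteristic (wp.adicCompletion K))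
    (hμ : ∀ ζ : MuCarrier (wp.adicCompletion K) (p ^ 1),
      (∀ σ : absoluteGaloisGroup (wp.adicCompletion K), mu (wp.adicCompletion K) (p ^ 1) σ ζ = ζ) →
        ζ = 0) :
    ∃ 𝓛 : AddSubgroup (galoisCohomology
        (GaloisRep.restrictField (wp.adicCompletion K) (V.torsionGaloisModule (p : ℤ))) 1),
      V.kummerLocalConditionAt (p : ℤ) (wp.adicCompletion K) ≤ 𝓛 ∧
      p ^ 1 * Nat.card (V.kummerLocalConditionAt (p : ℤ) (wp.adicCompletion K)) ≤ Nat.card 𝓛 ∧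
      ∀ c ∈ 𝓛, ∀ ψc : contOneCocycles (DiscreteGaloisModule.toTopRep
          (GaloisRep.restrictField (wp.adicCompletion K) (V.torsionGaloisModule (p : ℤ)))),
        oneCocycleClass _ ψc = c →
        ∀ g : absoluteGaloisGroup (wp.adicCompletion K), g ∈ absInertia (wp.adicCompletion K) →
          absGaloisRestrict K (wp.adicCompletion K) g ∈ H' →
          red (pointsMap V (wp.adicCompletion K) ((ψc.1 g : geomTorsion V (p : ℤ)) : geomPoints V))
            = 0 := by
  haveI : CharZero (wp.adicCompletion K) := charZero_adicCompletion wp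
  obtain ⟨𝓛, h𝓚, hidx, hstr⟩ := exists_strict_addSubgroup_mul_natCard V p wp hw hMK hred H' A₀ hA₀ s
    hs_red hs_anom ψ hI hψH' hEP hμ
  refine ⟨𝓛, h𝓚, ?_, hstr⟩
  -- `#E(K_wp)[p] ≥ 1` (it contains `0`)
  haveI : Finite (nsmulAddMonoidHom p :
      (V.baseChange (wp.adicCompletion K)).toAffine.Point →+ _).ker :=
    V.finite_ker_nsmul_adicCompletion wp hp.out.ne_zero
  have ht1 : 1 ≤ Nat.card (nsmulAddMonoidHom p :
      (V.baseChange (wp.adicCompletion K)).toAffine.Point →+ _).ker := Nat.card_pos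
  calc p ^ 1 * Nat.card (V.kummerLocalConditionAt (p : ℤ) (wp.adicCompletion K))
      = p * 1 * Nat.card (V.kummerLocalConditionAt (p : ℤ) (wp.adicCompletion K)) := by
        rw [pow_one, mul_one]
    _ ≤ p * Nat.card (nsmulAddMonoidHom p :
          (V.baseChange (wp.adicCompletion K)).toAffine.Point →+ _).ker *
        Nat.card (V.kummerLocalConditionAt (p : ℤ) (wp.adicCompletion K)) :=
        Nat.mul_le_mul_right _ (Nat.mul_le_mul_left _ ht1)
    _ ≤ Nat.card 𝓛 := hidx

end Summit.BirchSwinnertonDyer.Rank1Residual.X1.LocalStrictPackageOne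

end
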